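import Mathlib
import Literature.Probability.LatticeModels.ProdBernoulliIndependence
import Literature.Probability.Percolation.SharpnessDCTProofs
import Summits.CriticalPhenomena.PercolationContinuityZ3.Theorems.PercNearOneGluingNearOneGluingExposureDecomp
import Summits.CriticalPhenomena.PercolationContinuityZ3.Theorems.PercNearOneGluingNearOneGluingFewWeakFingersAux
import HarnessLib

/-!
# Crux `PercNearOneGluing.NearOneGluing` (stmt-CriticalPhenomena-4574), line
# `live-seal-vanishing-sprinkle` — stub `stub_fewWeakFingers` (few weak fingers)

Helper file for the crux (lead prover-line-stmt-CriticalPhenomena-4574-a1-0, wave 2b): proves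
exactly the registered stub `stub_fewWeakFingers` of the line skeleton. Lands with
`--supports stmt-CriticalPhenomena-4574`; the elementary inequalities are in the companion file
`…FewWeakFingersAux.lean`.

Setting: bond configurations `ω : Set (Sym2 (Fin n))` under `μ = prodBernoulli w`; a relay set `A`,
a source `o ∉ A`; the relay-free pocket `P ω` (`v ∈ P ω ↔ ω ∈ openConnIn (↑A)ᶜ o v`) and the
attached relays `E ω` (`a ∈ E ω ↔ a ∈ A ∧ ∃ x ∈ P ω, s(x, a) ∈ ω`). For a vertex set `T` and a
relay `a` put `q_a(T) = ∏_{x ∈ T} (1 - w s(x, a))` (probability that `a` is not attached to `T`)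
and `κ_A(T) = ∏_{a ∈ A} q_a(T)`.

## Statement (`stub_fewWeakFingers`)

If `μ(o ↮ A) ≤ η ≤ e^{-1/2}` and `1 ≤ m ≤ 2 log(1/η)`, the configurations with between `1` and
`m` attached relays, all of them weak (`q_a(P ω) ≥ 1/2`), have mass `≤ 4 m η (4 log(1/η))^m`.

## Proof

* `fewWeakFingers_real_class`: for `T` disjoint from `A` and `E₀ ⊆ A`, the class `{P = T}` is
  determined by the pairs inside `(↑A)ᶜ`, and "`a` attached to `T`" by the pair set
  `{s(x, a) : x ∈ T}`; these supports are pairwise disjoint, so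
  `μ(P = T ∧ attached set = E₀) = μ(P = T) ∏_{a ∈ E₀} (1 - q_a) ∏_{a ∈ A ∖ E₀} q_a`
  (`prodBernoulli_real_inter_biInter_of_determinedBy`).
* `fewWeakFingers_sum_kappa_le`: with `E₀ = ∅`, `{P = T, nothing attached} ⊆ {o ↮ A}` (the first
  exit of an open `o–a` path from the pocket is an attached relay, `exposureDecomp_exists_attached`),
  so `Σ_T μ(P = T) κ_A(T) ≤ μ(o ↮ A) ≤ η`.
* `fewWeakFingers_class_le`: on `{P = T}` the event forces `E ω = E₀` for some `E₀ ⊆ W_T` (weak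
  relays) with `1 ≤ |E₀| ≤ m`; a weak index costs `1 - q_a ≤ q_a · 2(1 - q_a)`, whence
  `μ(F ∩ {P = T}) ≤ μ(P = T) κ_A(T) Σ_{E₀} ∏_{a ∈ E₀} 2(1 - q_a)`.
* the companion file bounds the last factor by `m (f_1 + f_m)(κ_A(T))`, `f_j(κ) = κ(-2 log κ)^j`
  (`e_j ≤ (Σ 2p_a)^j ≤ (2 log(1/κ_A))^j`), and `f_j(κ) ≤ (κ + η)(4 log(1/η))^j` for `j ≤ 2 log(1/η)`;
  summing over `T` with `Σ_T μ(P = T) κ_A(T) ≤ η`, `Σ_T μ(P = T) = 1` gives `4 m η (4 log(1/η))^m`.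
-/

namespace Summit.CriticalPhenomena.PercolationContinuityZ3.Theorems

open scoped BigOperators Classical
open MeasureTheory Set
open Literature.Probability.LatticeModels (prodBernoulli prodBernoulli_real_forall_notMem
  prodBernoulli_real_inter_biInter_of_determinedBy)
open Literature.Probability.Percolation

section FewWeakFingersProb

variable {n : ℕ}

/-- **Cylinder probability of non-attachment.** `μ{∀ x ∈ T, s(x, a) closed} = ∏_{x ∈ T} (1 - w s(x, a))`. -/
theorem fewWeakFingers_real_forall_notMem (w : Sym2 (Fin n) → unitInterval) (T : Finset (Fin n))
    (a : Fin n) :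
    (prodBernoulli w).real {ω | ∀ x ∈ T, s(x, a) ∉ ω} = ∏ x ∈ T, (1 - (w s(x, a) : ℝ)) := by
  have hinj : Set.InjOn (fun x : Fin n => s(x, a)) ↑T := by
    intro x _ x' _ h
    rcases Sym2.eq_iff.1 h with ⟨h1, -⟩ | ⟨h1, h2⟩
    · exact h1
    · exact h1.trans h2
  have hset : {ω : Set (Sym2 (Fin n)) | ∀ x ∈ T, s(x, a) ∉ ω} =
      {ω | ∀ e ∈ T.image (fun x => s(x, a)), e ∉ ω} := by
    ext ω
    simp only [Set.mem_setOf_eq, Finset.forall_mem_image]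
  rw [hset, prodBernoulli_real_forall_notMem, Finset.prod_image hinj]

/-- **Probability of attachment.** `μ{∃ x ∈ T, s(x, a) open} = 1 - ∏_{x ∈ T} (1 - w s(x, a))`. -/
theorem fewWeakFingers_real_exists_mem (w : Sym2 (Fin n) → unitInterval) (T : Finset (Fin n))
    (a : Fin n) :
    (prodBernoulli w).real {ω | ∃ x ∈ T, s(x, a) ∈ ω} = 1 - ∏ x ∈ T, (1 - (w s(x, a) : ℝ)) := by
  have h : {ω : Set (Sym2 (Fin n)) | ∃ x ∈ T, s(x, a) ∈ ω} = {ω | ∀ x ∈ T, s(x, a) ∉ ω}ᶜ := by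
    ext ω
    simp
  rw [h, probReal_compl_eq_one_sub MeasurableSet.of_discrete, fewWeakFingers_real_forall_notMem]

variable {A : Finset (Fin n)} {o : Fin n} {P : Set (Sym2 (Fin n)) → Finset (Fin n)}

/-- **Factorisation on a pocket class.** For `T` disjoint from `A` and any `E₀`:
`μ({P = T} ∩ {∀ a ∈ A, (a ∈ E₀ ↔ a attached to T)}) = μ(P = T) · ∏_{a ∈ A} (a ∈ E₀ ? 1 - q_a : q_a)`,
`q_a = ∏_{x ∈ T} (1 - w s(x, a))`: the class is determined by the pairs inside `(↑A)ᶜ`, the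
attachment of `a` by the pairs `{s(x, a) : x ∈ T}`, and these supports are pairwise disjoint
(`prodBernoulli_real_inter_biInter_of_determinedBy`). -/
theorem fewWeakFingers_real_class (w : Sym2 (Fin n) → unitInterval)
    (hP : ∀ ω v, v ∈ P ω ↔ ω ∈ openConnIn ((↑A : Set (Fin n))ᶜ) o v)
    (T : Finset (Fin n)) (hTA : Disjoint T A) (E₀ : Finset (Fin n)) (q : Fin n → ℝ)
    (hq : ∀ a, q a = ∏ x ∈ T, (1 - (w s(x, a) : ℝ))) :
    (prodBernoulli w).real (P ⁻¹' {T} ∩ {ω | ∀ a ∈ A, (a ∈ E₀ ↔ ∃ x ∈ T, s(x, a) ∈ ω)}) =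
      (prodBernoulli w).real (P ⁻¹' {T}) * ∏ a ∈ A, (if a ∈ E₀ then 1 - q a else q a) := by
  set S : Fin n → Finset (Sym2 (Fin n)) := fun a => T.image (fun x => s(x, a)) with hS
  set C : Fin n → Set (Set (Sym2 (Fin n))) :=
    fun a => {ω | a ∈ E₀ ↔ ∃ x ∈ T, s(x, a) ∈ ω} with hC
  have hInter : {ω : Set (Sym2 (Fin n)) | ∀ a ∈ A, (a ∈ E₀ ↔ ∃ x ∈ T, s(x, a) ∈ ω)} =
      ⋂ a ∈ A, C a := by
    ext ω
    simp only [hC, Set.mem_setOf_eq, Set.mem_iInter]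
  have hmemS : ∀ a x, x ∈ T → s(x, a) ∈ (↑(S a) : Set (Sym2 (Fin n))) := fun a x hx =>
    Finset.mem_coe.2 (Finset.mem_image.2 ⟨x, hx, rfl⟩)
  -- pairwise disjoint supports
  have hdisj : (↑A : Set (Fin n)).PairwiseDisjoint S := by
    intro a ha a' _ hne
    simp only [Function.onFun]
    rw [Finset.disjoint_left]
    intro e he he'
    obtain ⟨x, hx, rfl⟩ := Finset.mem_image.1 he
    obtain ⟨x', hx', hxx'⟩ := Finset.mem_image.1 he'
    rcases Sym2.eq_iff.1 hxx' with ⟨-, h2⟩ | ⟨h1, -⟩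
    · exact hne h2.symm
    · exact Finset.disjoint_left.1 hTA hx' (h1 ▸ Finset.mem_coe.1 ha)
  have hCdet : ∀ a ∈ A, DeterminedBy (C a) (↑(S a) : Set (Sym2 (Fin n))) := by
    intro a _
    rw [determinedBy_iff]
    intro ω ω' h
    simp only [hC, Set.mem_setOf_eq]
    refine iff_congr Iff.rfl (exists_congr fun x => and_congr_right fun hx => ?_)
    exact ⟨fun h1 => (((Set.ext_iff.1 h) _).1 ⟨h1, hmemS a x hx⟩).1,
      fun h1 => (((Set.ext_iff.1 h) _).2 ⟨h1, hmemS a x hx⟩).1⟩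
  have hAdet : DeterminedBy (P ⁻¹' {T}) (⋃ a ∈ A, (↑(S a) : Set (Sym2 (Fin n))))ᶜ := by
    have hK : ((↑A : Set (Fin n))ᶜ).sym2 ⊆ (⋃ a ∈ A, (↑(S a) : Set (Sym2 (Fin n))))ᶜ := by
      intro e he heU
      simp only [Set.mem_iUnion, exists_prop] at heU
      obtain ⟨a, ha, heS⟩ := heU
      obtain ⟨x, _, rfl⟩ := Finset.mem_image.1 (Finset.mem_coe.1 heS)
      exact (Set.mk_mem_sym2_iff.1 he).2 ha
    rw [determinedBy_iff]
    intro ω ω' h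
    simp only [Set.mem_preimage, Set.mem_singleton_iff]
    have hPP : P ω = P ω' := by
      ext v
      rw [hP ω v, hP ω' v]
      exact (determinedBy_iff _ _).1 (DCT16.determinedBy_openConnIn _ o v hK) ω ω' h
    rw [hPP]
  have hreal : ∀ a ∈ A, (prodBernoulli w).real (C a) = if a ∈ E₀ then 1 - q a else q a := by
    intro a _
    by_cases haE : a ∈ E₀
    · rw [if_pos haE, hq a]
      have : C a = {ω | ∃ x ∈ T, s(x, a) ∈ ω} := by
        ext ω
        simp only [hC, Set.mem_setOf_eq, haE, true_iff]
      rw [this, fewWeakFingers_real_exists_mem]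
    · rw [if_neg haE, hq a]
      have : C a = {ω | ∀ x ∈ T, s(x, a) ∉ ω} := by
        ext ω
        simp only [hC, Set.mem_setOf_eq, haE, false_iff, not_exists, not_and]
      rw [this, fewWeakFingers_real_forall_notMem]
  rw [hInter, prodBernoulli_real_inter_biInter_of_determinedBy w A S hdisj hCdet
    (fun _ _ => MeasurableSet.of_discrete) hAdet MeasurableSet.of_discrete]
  exact congrArg _ (Finset.prod_congr rfl hreal)

/-- **`Σ_T μ(P = T) κ_A(T) ≤ μ(o ↮ A)`.** On `{P = T}` with no relay attached to `T`, `o ↮ A`: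
the first exit of an open `o–a` path from the pocket is an attached relay
(`exposureDecomp_exists_attached`); and `μ(P = T, nothing attached) = μ(P = T) κ_A(T)`. -/
theorem fewWeakFingers_sum_kappa_le (w : Sym2 (Fin n) → unitInterval)
    (hP : ∀ ω v, v ∈ P ω ↔ ω ∈ openConnIn ((↑A : Set (Fin n))ᶜ) o v) (ho : o ∉ A) :
    ∑ T : Finset (Fin n), (prodBernoulli w).real (P ⁻¹' {T}) *
        ∏ a ∈ A, ∏ x ∈ T, (1 - (w s(x, a) : ℝ)) ≤
      (prodBernoulli w).real (⋃ a ∈ A, openConn o a)ᶜ := by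
  set μ := prodBernoulli w with hμ
  set N : Set (Set (Sym2 (Fin n))) := (⋃ a ∈ A, openConn o a)ᶜ with hN
  have hT : ∀ T : Finset (Fin n), μ.real (P ⁻¹' {T}) * ∏ a ∈ A, ∏ x ∈ T, (1 - (w s(x, a) : ℝ)) ≤
      μ.real (P ⁻¹' {T} ∩ N) := by
    intro T
    by_cases hTA : Disjoint T A
    · have h := fewWeakFingers_real_class w hP T hTA ∅ (fun a => ∏ x ∈ T, (1 - (w s(x, a) : ℝ)))
        (fun _ => rfl)
      simp only [Finset.notMem_empty, false_iff, if_false] at h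
      rw [← h]
      refine measureReal_mono ?_ (measure_ne_top _ _)
      rintro ω ⟨hPT, hnone⟩
      refine ⟨hPT, ?_⟩
      rw [Set.mem_preimage, Set.mem_singleton_iff] at hPT
      simp only [hN, Set.mem_compl_iff, Set.mem_iUnion, exists_prop, not_exists, not_and]
      intro a ha hoa
      obtain ⟨y, hyA, x, hxP, hxy⟩ := exposureDecomp_exists_attached hP ho ha hoa
      rw [hPT] at hxP
      exact hnone y hyA ⟨x, hxP, hxy⟩
    · have h0 : P ⁻¹' {T} = ∅ := Set.eq_empty_iff_forall_notMem.2 fun ω hω => hTA (by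
        rw [Set.mem_preimage, Set.mem_singleton_iff] at hω
        rw [← hω]
        exact exposureDecomp_pocket_disjoint hP ω)
      rw [h0, Set.empty_inter, measureReal_empty, zero_mul]
  have hrestr : ∀ T : Finset (Fin n), μ.real (P ⁻¹' {T} ∩ N) = (μ.restrict N).real (P ⁻¹' {T}) :=
    fun T => (measureReal_restrict_apply MeasurableSet.of_discrete).symm
  calc ∑ T : Finset (Fin n), μ.real (P ⁻¹' {T}) * ∏ a ∈ A, ∏ x ∈ T, (1 - (w s(x, a) : ℝ))
      ≤ ∑ T : Finset (Fin n), μ.real (P ⁻¹' {T} ∩ N) := Finset.sum_le_sum fun T _ => hT T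
    _ = ∑ T : Finset (Fin n), (μ.restrict N).real (P ⁻¹' {T}) := Finset.sum_congr rfl fun T _ => hrestr T
    _ = μ.real N := by
        rw [sum_measureReal_preimage_singleton _ (fun _ _ => MeasurableSet.of_discrete),
          Finset.coe_univ, Set.preimage_univ, measureReal_restrict_apply MeasurableSet.univ,
          Set.univ_inter]

/-- **Per-class estimate.** On `{P = T}` the few-weak-fingers event forces the attached set `E ω`
to be some `E₀ ⊆ W_T = {a ∈ A | q_a ≥ 1/2}` with `1 ≤ |E₀| ≤ m`, and
`μ(P = T, attached set = E₀) ≤ μ(P = T) κ_A(T) ∏_{a ∈ E₀} 2(1 - q_a)` (weak indices cost a factor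
`≤ 2` each); summing over `E₀`:
`μ(F ∩ {P = T}) ≤ μ(P = T) · κ_A(T) · Σ_{E₀ ⊆ W_T, 1 ≤ |E₀| ≤ m} ∏_{a ∈ E₀} 2(1 - q_a)`. -/
theorem fewWeakFingers_class_le (w : Sym2 (Fin n) → unitInterval) (m : ℕ)
    (hP : ∀ ω v, v ∈ P ω ↔ ω ∈ openConnIn ((↑A : Set (Fin n))ᶜ) o v)
    (E : Set (Sym2 (Fin n)) → Finset (Fin n))
    (hE : ∀ ω a, a ∈ E ω ↔ a ∈ A ∧ ∃ x ∈ P ω, s(x, a) ∈ ω)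
    (T : Finset (Fin n)) (q : Fin n → ℝ) (hq : ∀ a, q a = ∏ x ∈ T, (1 - (w s(x, a) : ℝ))) :
    (prodBernoulli w).real ({ω | 1 ≤ (E ω).card ∧ (E ω).card ≤ m ∧
        ∀ a ∈ E ω, (1 / 2 : ℝ) ≤ ∏ x ∈ P ω, (1 - (w s(x, a) : ℝ))} ∩ P ⁻¹' {T}) ≤
      (prodBernoulli w).real (P ⁻¹' {T}) * ((∏ a ∈ A, q a) *
        ∑ E₀ ∈ (A.filter fun a => (1 / 2 : ℝ) ≤ q a).powerset.filter
            (fun E₀ => 1 ≤ E₀.card ∧ E₀.card ≤ m), ∏ a ∈ E₀, 2 * (1 - q a)) := by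
  set μ := prodBernoulli w with hμ
  set F : Set (Set (Sym2 (Fin n))) := {ω | 1 ≤ (E ω).card ∧ (E ω).card ≤ m ∧
    ∀ a ∈ E ω, (1 / 2 : ℝ) ≤ ∏ x ∈ P ω, (1 - (w s(x, a) : ℝ))} with hF
  set W := A.filter fun a => (1 / 2 : ℝ) ≤ q a with hW
  set 𝓔 := W.powerset.filter (fun E₀ => 1 ≤ E₀.card ∧ E₀.card ≤ m) with h𝓔
  set D : Finset (Fin n) → Set (Set (Sym2 (Fin n))) :=
    fun E₀ => {ω | ∀ a ∈ A, (a ∈ E₀ ↔ ∃ x ∈ T, s(x, a) ∈ ω)} with hD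
  have hq0 : ∀ a, 0 ≤ q a := fun a => by
    rw [hq a]; exact Finset.prod_nonneg fun x _ => sub_nonneg.2 (w _).2.2
  have hq1 : ∀ a, q a ≤ 1 := fun a => by
    rw [hq a]
    exact Finset.prod_le_one (fun x _ => sub_nonneg.2 (w _).2.2) fun x _ => sub_le_self _ (w _).2.1
  have hWA : W ⊆ A := Finset.filter_subset _ _
  by_cases hTA : Disjoint T A
  swap
  · have h0 : P ⁻¹' {T} = ∅ := Set.eq_empty_iff_forall_notMem.2 fun ω hω => hTA (by
      rw [Set.mem_preimage, Set.mem_singleton_iff] at hω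
      rw [← hω]
      exact exposureDecomp_pocket_disjoint hP ω)
    rw [h0, Set.inter_empty, measureReal_empty, zero_mul]
  have hcover : F ∩ P ⁻¹' {T} ⊆ ⋃ E₀ ∈ 𝓔, (P ⁻¹' {T} ∩ D E₀) := by
    rintro ω ⟨⟨h1, h2, h3⟩, hPT⟩
    have hPT' : P ω = T := by
      rw [Set.mem_preimage, Set.mem_singleton_iff] at hPT
      exact hPT
    simp only [Set.mem_iUnion, exists_prop]
    refine ⟨E ω, ?_, hPT, ?_⟩
    · rw [h𝓔, Finset.mem_filter, Finset.mem_powerset]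
      refine ⟨fun a ha => ?_, h1, h2⟩
      obtain ⟨haA, -⟩ := (hE ω a).1 ha
      rw [hW, Finset.mem_filter]
      refine ⟨haA, ?_⟩
      rw [hq a, ← hPT']
      exact h3 a ha
    · intro a haA
      rw [hE ω a, hPT']
      exact ⟨fun h => h.2, fun h => ⟨haA, h⟩⟩
  have hclass : ∀ E₀ ∈ 𝓔, μ.real (P ⁻¹' {T} ∩ D E₀) ≤
      μ.real (P ⁻¹' {T}) * ((∏ a ∈ A, q a) * ∏ a ∈ E₀, 2 * (1 - q a)) := by
    intro E₀ hE₀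
    rw [fewWeakFingers_real_class w hP T hTA E₀ q hq]
    refine mul_le_mul_of_nonneg_left ?_ measureReal_nonneg
    have hE₀W : E₀ ⊆ W := Finset.mem_powerset.1 (Finset.mem_filter.1 hE₀).1
    exact fewWeakFingers_prod_ite_le q A E₀ (hE₀W.trans hWA) (fun a _ => hq0 a) (fun a _ => hq1 a)
      (fun a ha => (Finset.mem_filter.1 (hE₀W ha)).2)
  calc μ.real (F ∩ P ⁻¹' {T}) ≤ μ.real (⋃ E₀ ∈ 𝓔, (P ⁻¹' {T} ∩ D E₀)) :=
        measureReal_mono hcover (measure_ne_top _ _)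
    _ ≤ ∑ E₀ ∈ 𝓔, μ.real (P ⁻¹' {T} ∩ D E₀) := measureReal_biUnion_finset_le _ _
    _ ≤ ∑ E₀ ∈ 𝓔, μ.real (P ⁻¹' {T}) * ((∏ a ∈ A, q a) * ∏ a ∈ E₀, 2 * (1 - q a)) :=
        Finset.sum_le_sum hclass
    _ = _ := by rw [← Finset.mul_sum, ← Finset.mul_sum]

end FewWeakFingersProb

/-- **Stub 7 of the line `live-seal-vanishing-sprinkle` (few weak fingers).** With
`η ≥ μ(o ↮ A) = E[κ_A(S₀)]` (`κ_A(T) = ∏_{a ∈ A} q_a(T)`, `q_a(T) = ∏_{x ∈ T} (1 - w s(x,a))` =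
probability that the relay `a` is NOT attached to the pocket `T`; `o ↮ A ⟺ E* = ∅`): the
configurations whose relay-free pocket has between `1` and `m` attached relays, all of them WEAK
(`q_a(S₀) ≥ 1/2`), have mass `≤ 4 m η (4 log(1/η))^m` whenever `1 ≤ m ≤ 2 log(1/η)` and
`η ≤ e^{-1/2}`.  Proof: partition by `T = P ω`; given `{P = T}` (determined by the pairs inside
`(↑A)ᶜ`) the attachment indicators are independent Bernoulli(`p_a = 1 - q_a(T)`) (pair sets
`{s(x,a) : x ∈ T}` disjoint across `a`): `μ(P = T ∧ E = E₀) = μ(P = T)·∏_{a∈E₀} p_a ∏_{a∉E₀} q_a`;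
for weak `a`, `p_a ≤ q_a · 2 p_a`, and `Σ_{E₀ ⊆ W, |E₀| = j} ∏_{a∈E₀} 2p_a ≤ (2 Σ_{a∈W} p_a)^j ≤
(2Λ_T)^j` with `Λ_T = log(1/κ_A(T)) ≥ Σ_a p_a` (`p ≤ -log(1-p)`); hence
`μ(F ∩ {P = T}) ≤ μ(P = T)·κ_A(T)·Σ_{j=1}^m (2Λ_T)^j ≤ μ(P=T)·m·(f_1 + f_m)(κ_A(T))`,
`f_j(κ) = κ (2 log(1/κ))^j`; finally `f_j(κ) ≤ (κ + η)(4 log(1/η))^j` for `j ≤ 2 log(1/η)`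
(split at `κ = η²`; below, `f_j` is increasing on `(0, e^{-j}] ∋ η²`), and
`Σ_T μ(P = T) κ_A(T) ≤ η`, `Σ_T μ(P = T) = 1`. -/
theorem stub_fewWeakFingers (n : ℕ) (w : Sym2 (Fin n) → unitInterval) (A : Finset (Fin n))
    (o : Fin n) (ho : o ∉ A) (η : ℝ) (hη0 : 0 < η) (hη1 : η ≤ Real.exp (-(1 / 2 : ℝ)))
    (m : ℕ) (hm1 : 1 ≤ m) (hm2 : (m : ℝ) ≤ 2 * Real.log (1 / η))
    (hoA : (prodBernoulli w).real (⋃ a ∈ A, openConn o a)ᶜ ≤ η)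
    (P : Set (Sym2 (Fin n)) → Finset (Fin n))
    (hP : ∀ ω v, v ∈ P ω ↔ ω ∈ openConnIn ((↑A : Set (Fin n))ᶜ) o v)
    (E : Set (Sym2 (Fin n)) → Finset (Fin n))
    (hE : ∀ ω a, a ∈ E ω ↔ a ∈ A ∧ ∃ x ∈ P ω, s(x, a) ∈ ω) :
    (prodBernoulli w).real {ω | 1 ≤ (E ω).card ∧ (E ω).card ≤ m ∧
        ∀ a ∈ E ω, (1 / 2 : ℝ) ≤ ∏ x ∈ P ω, (1 - (w s(x, a) : ℝ))} ≤
      4 * m * η * (4 * Real.log (1 / η)) ^ m := by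
  set μ := prodBernoulli w with hμ
  set F : Set (Set (Sym2 (Fin n))) := {ω | 1 ≤ (E ω).card ∧ (E ω).card ≤ m ∧
    ∀ a ∈ E ω, (1 / 2 : ℝ) ≤ ∏ x ∈ P ω, (1 - (w s(x, a) : ℝ))} with hF
  -- the logarithmic scale
  have hL : Real.log (1 / η) = -Real.log η := by rw [one_div, Real.log_inv]
  have hη1' : η ≤ 1 := hη1.trans (Real.exp_le_one_iff.2 (by norm_num))
  have hLhalf : 1 / 2 ≤ -Real.log η := by
    have h := Real.log_le_log hη0 hη1
    rw [Real.log_exp] at h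
    linarith
  have h4L : 1 ≤ 4 * (-Real.log η) := by linarith
  have hm2' : (m : ℝ) ≤ 2 * (-Real.log η) := by rw [← hL]; exact hm2
  rw [hL]
  -- the non-attachment probabilities `q_a(T)` and `κ_A(T)`
  obtain ⟨q, hq⟩ : ∃ q : Finset (Fin n) → Fin n → ℝ,
      ∀ T a, q T a = ∏ x ∈ T, (1 - (w s(x, a) : ℝ)) := ⟨_, fun _ _ => rfl⟩
  have hq0 : ∀ T a, 0 ≤ q T a := fun T a => by
    rw [hq T a]; exact Finset.prod_nonneg fun x _ => sub_nonneg.2 (w _).2.2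
  have hq1 : ∀ T a, q T a ≤ 1 := fun T a => by
    rw [hq T a]
    exact Finset.prod_le_one (fun x _ => sub_nonneg.2 (w _).2.2) fun x _ => sub_le_self _ (w _).2.1
  have hκ0 : ∀ T, 0 ≤ ∏ a ∈ A, q T a := fun T => Finset.prod_nonneg fun a _ => hq0 T a
  have hκ1 : ∀ T, ∏ a ∈ A, q T a ≤ 1 := fun T =>
    Finset.prod_le_one (fun a _ => hq0 T a) fun a _ => hq1 T a
  -- per-class bound
  have hT : ∀ T : Finset (Fin n), μ.real (F ∩ P ⁻¹' {T}) ≤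
      μ.real (P ⁻¹' {T}) * ((m : ℝ) * (((∏ a ∈ A, q T a) + η) * (2 * (4 * (-Real.log η)) ^ m))) := by
    intro T
    refine (fewWeakFingers_class_le w m hP E hE T (q T) (hq T)).trans ?_
    refine mul_le_mul_of_nonneg_left ?_ measureReal_nonneg
    refine (fewWeakFingers_class_sum_le (q T) A (A.filter fun a => (1 / 2 : ℝ) ≤ q T a)
      (Finset.filter_subset _ _) (fun a _ => hq0 T a) (fun a _ => hq1 T a) m).trans ?_
    refine mul_le_mul_of_nonneg_left ?_ (Nat.cast_nonneg m)
    have hf1 := fewWeakFingers_f_le (hκ0 T) (hκ1 T) hη0 hη1' (le_refl 1)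
      (by rw [Nat.cast_one]; linarith)
    have hfm := fewWeakFingers_f_le (hκ0 T) (hκ1 T) hη0 hη1' hm1 hm2'
    rw [pow_one, pow_one] at hf1
    have hLm : 4 * (-Real.log η) ≤ (4 * (-Real.log η)) ^ m := le_self_pow₀ h4L (by omega)
    have hkη : 0 ≤ (∏ a ∈ A, q T a) + η := by linarith [hκ0 T]
    have h3 := mul_le_mul_of_nonneg_left hLm hkη
    linarith
  -- partition by the pocket
  have hcover : F ⊆ ⋃ T ∈ (Finset.univ : Finset (Finset (Fin n))), (F ∩ P ⁻¹' {T}) := by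
    intro ω hω
    simp only [Set.mem_iUnion, exists_prop]
    exact ⟨P ω, Finset.mem_univ _, hω, rfl⟩
  have hsum1 : ∑ T : Finset (Fin n), μ.real (P ⁻¹' {T}) = 1 := by
    rw [sum_measureReal_preimage_singleton _ (fun _ _ => MeasurableSet.of_discrete),
      Finset.coe_univ, Set.preimage_univ, probReal_univ]
  have hsumκ : ∑ T : Finset (Fin n), μ.real (P ⁻¹' {T}) * ∏ a ∈ A, q T a ≤ η := by
    have h := fewWeakFingers_sum_kappa_le w hP ho
    refine le_trans (le_of_eq (Finset.sum_congr rfl fun T _ => ?_)) (h.trans hoA)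
    rw [Finset.prod_congr rfl fun a _ => hq T a]
  have hC0 : 0 ≤ (m : ℝ) * (2 * (4 * (-Real.log η)) ^ m) :=
    mul_nonneg (Nat.cast_nonneg m) (mul_nonneg zero_le_two (pow_nonneg (by linarith) m))
  calc μ.real F ≤ μ.real (⋃ T ∈ (Finset.univ : Finset (Finset (Fin n))), (F ∩ P ⁻¹' {T})) :=
        measureReal_mono hcover (measure_ne_top _ _)
    _ ≤ ∑ T : Finset (Fin n), μ.real (F ∩ P ⁻¹' {T}) := measureReal_biUnion_finset_le _ _
    _ ≤ ∑ T : Finset (Fin n), μ.real (P ⁻¹' {T}) *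
          ((m : ℝ) * (((∏ a ∈ A, q T a) + η) * (2 * (4 * (-Real.log η)) ^ m))) :=
        Finset.sum_le_sum fun T _ => hT T
    _ = ((m : ℝ) * (2 * (4 * (-Real.log η)) ^ m)) *
          (∑ T : Finset (Fin n), μ.real (P ⁻¹' {T}) * ∏ a ∈ A, q T a +
            η * ∑ T : Finset (Fin n), μ.real (P ⁻¹' {T})) := by
        rw [Finset.mul_sum, ← Finset.sum_add_distrib, Finset.mul_sum]
        exact Finset.sum_congr rfl fun T _ => by ring
    _ ≤ ((m : ℝ) * (2 * (4 * (-Real.log η)) ^ m)) * (η + η * 1) := by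
        rw [hsum1]
        exact mul_le_mul_of_nonneg_left (by linarith) hC0
    _ = 4 * m * η * (4 * (-Real.log η)) ^ m := by ring

end Summit.CriticalPhenomena.PercolationContinuityZ3.Theorems
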